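import Literature.NumberTheory.EllipticCurves.KubertTateFiveMuDescentEisensteinBox
import Literature.NumberTheory.EllipticCurves.KubertTateFiveGaussianTwistShaCriterion
import Literature.NumberTheory.NumberFields.EisensteinFieldPrimes
import Mathlib.Tactic.NormNum.Prime
import HarnessLib

/-!
# CLASS-WIDE: the quadratic twist by `-3` of an Eisenstein-tame Kubert–Tate `5`-torsion curve with full `ℚ`-box —
# `rank E_{m,n}^{(-3)}(ℚ) ≤ ω₂(mn)`, and the DOOR AT `5` ON THE TWIST decided by the rank
# (`5`-descent over the Eisenstein field `ℚ(ζ₃) = ℚ(√-3)`)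

PROOF-ONLY file (theorems only, no definition, no named fact, no `sorry`), topic `NumberTheory/EllipticCurves`; the
Eisenstein twin of the tree's `KubertTateFiveGaussianTwistRankZero` / `…RankBound` / `…ShaCriterion` (`ℚ(i)`, twists
by `-4`).  Setting: `E = E_{m,n} = [n−m, −mn, −mn², 0, 0]` over `ℚ`; `K = K3`, the tree's model of `ℚ(ζ₃)`
(`EisensteinField*`: `𝓞 K3 = ℤ[ζ₃]` principal, `3 = -ζ₃²λ²` ramified, `ℓ ≡ 2 (3)` inert, `ℓ ≡ 1 (3)` split as
`(a + bζ₃)(a + bζ₃²)`); `d_{K3} = -3`; `ω(mn) = #{ℓ ∣ mn}`, `ω₂(mn) = #{ℓ ∣ mn : ℓ ≡ 1 (mod 3)}`.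
EISENSTEIN TAME RÉGIME: `5 ∤ Δ`, every bad `ℓ` has `ℓ ≢ 1 (mod 5)` and (`ℓ ≡ 4 (mod 5) ⇒ ℓ ≡ 1 (mod 3)`).

* §1 `discr_K3` (`d = -3`), `exists_two_places_three` (the places of `ℚ(ζ₃)` above `ℓ`: two iff `ℓ ≡ 1 (3)`),
  `exists_support_split_three` — **a supporting set of places with `#S ≤ ω(mn) + ω₂(mn)`**.
* §2 `mordellWeilRank_base_eq_add_three` — `rank E(ℚ(ζ₃)) = rank E(ℚ) + rank E^{(-3)}(ℚ)` (tree
  `mordellWeilRank_baseChange_quadratic_holds` at `K3`).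
* §3 (tame, reference point a rational `(x, y)` with `x ∉ {0, mn}` and a good prime `q ≤ 11`, `q ≠ 5`):
  **`mordellWeilRank_baseChange_succ_le_three`** (`rank E_{m,n}(ℚ(ζ₃)) + 1 ≤ ω + ω₂`),
  `mordellWeilRank_twist_le_three`, **`mordellWeilRank_twist_le_card_split_three`** (`rank E^{(-3)}(ℚ) ≤ ω₂(mn)`
  when the `ℚ`-box is full, `ω(mn) ≤ rank E(ℚ) + 1`), and **THE DOOR AT `5` ON THE TWIST DECIDED BY THE RANK**
  `twist_door_of_le_rank_three`: if moreover `ω₂(mn) ≤ rank E^{(-3)}(ℚ)` then **`t₅(E^{(-3)}/ℚ) = 0`**, `t₅(E/ℚ) = 0`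
  and `rank E^{(-3)}(ℚ) = ω₂(mn)` — in particular (`ω₂ = 0`) `twist_rank_zero_three`: `rank E^{(-3)} = 0 ∧ t₅(E^{(-3)}) = 0`.

Why (stmt-BirchSwinnertonDyer-22356, «T = FiniteShaComponentTransfer»; BSD and T are NOT proved by this): the twists
`E_{m,n}^{(-3)}` have no rational `5`-torsion, and `5` is INERT in `ℚ(√-3)`, so `a₅(E^{(-3)}) = -a₅(E) ≡ -1 (mod 5)`:
the door prime `5` of the twist is a NON-anomalous Eisenstein prime — inside the printed scope of the refereed
`p`-converse of Castella–Grossi–Lee–Skinner (Invent. Math. 227 (2022), Thm. E), unlike the anomalous Gaussian twists.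
Instances: `KubertTateM223EisensteinTwist` (rank `0`), `KubertTate373EisensteinTwist` (rank `1`).

## References

* [SilvermanAEC2009] J. H. Silverman, *AEC*, 2nd ed., Thm. X.4.2, Prop. X.4.9, Exercise 10.16.
* [Fisher2001FiveSevenDescent] T. Fisher, JEMS 3 (2001), §§1–2.
* [IrelandRosen1982] K. Ireland, M. Rosen, *A Classical Introduction to Modern Number Theory*, Ch. 9 §1 Prop. 9.1.4.
* [Dokchitser2013ParityNotes] T. Dokchitser, Notes on the parity conjecture (2013), §4.
-/

noncomputable section

open scoped Classical NNReal NumberField AddSubgroup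
open WeierstrassCurve WeierstrassCurve.Isogeny Field IsDedekindDomain Ideal
open Literature.NumberTheory.EllipticCurves Literature.NumberTheory.EllipticCurves.KubertTateVelu
  Literature.NumberTheory.EllipticCurves.KubertTateMuDescentNF Literature.NumberTheory.NumberFields
  Literature.NumberTheory.EllipticCurves.KubertTateGaussianTwist

namespace Literature.NumberTheory.EllipticCurves

namespace KubertTateEisensteinTwist

variable (m n : ℤ) [hEQ : (kubertTateFive (m : ℚ) (n : ℚ)).IsElliptic]

/-! ## §1 The Eisenstein field: discriminant `-3`, the places above a rational prime, supporting sets -/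

/-- `d_{ℚ(ζ₃)} = -3` (Mathlib's cyclotomic discriminant `(-1)^{(p-1)/2} p^{p-2}` at `p = 3`, on the tree's model `K3`).
[cite: IrelandRosen1982, Ch. 13 §2] -/
theorem discr_K3 : NumberField.discr K3 = -3 := by
  haveI : Fact (Nat.Prime 3) := ⟨Nat.prime_three⟩
  have h := IsCyclotomicExtension.Rat.discr_prime 3 K3
  rw [h]; norm_num

/-- `(ℓ : 𝓞 K3) = ((ℓ : ℤ) : 𝓞 K3)`. [folklore] -/
private theorem natCast_eq_intCast (ℓ : ℕ) : (ℓ : 𝓞 K3) = ((ℓ : ℤ) : 𝓞 K3) := by push_cast; rfl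

/-- Every rational prime lies under some finite place of `ℚ(ζ₃)`. [cite: IrelandRosen1982, Ch. 9 §1] -/
private theorem exists_natCast_mem_asIdeal_three {ℓ : ℕ} (hℓ : ℓ.Prime) :
    ∃ v : HeightOneSpectrum (𝓞 K3), (ℓ : 𝓞 K3) ∈ v.asIdeal := by
  haveI := Fact.mk hℓ
  obtain ⟨⟨P, hP, hPover⟩⟩ := (span {(ℓ : ℤ)}).nonempty_primesOver (S := 𝓞 K3)
  have hℓZ : (ℓ : ℤ) ≠ 0 := Int.natCast_ne_zero.mpr hℓ.ne_zero
  have hP0 : P ≠ ⊥ := Ideal.ne_bot_of_liesOver_of_ne_bot (p := span {(ℓ : ℤ)}) (by simpa using hℓZ) P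
  refine ⟨⟨P, hP, hP0⟩, ?_⟩
  have h : ((ℓ : ℤ) : ℤ) ∈ span {(ℓ : ℤ)} := mem_span_singleton_self _
  rw [mem_of_liesOver P] at h
  simpa using h

/-- **The places of `ℚ(ζ₃)` above a rational prime `ℓ`**: there are places `v₁ ∋ ℓ`, `v₂ ∋ ℓ` such that every place
containing `ℓ` is `v₁` or `v₂`, and `v₁ = v₂` unless `ℓ ≡ 1 (mod 3)` (`3 = -ζ²λ²` ramifies, `ℓ ≡ 2 (3)` is inert,
`ℓ ≡ 1 (3)` splits as `(a + bζ)(a − b − bζ)` with `ℓ = a² − ab + b²`; tree `EisensteinFieldPrimes`).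
[cite: IrelandRosen1982, Ch. 9 §1 Prop. 9.1.4] -/
theorem exists_two_places_three {ℓ : ℕ} (hℓ : ℓ.Prime) :
    ∃ v₁ v₂ : HeightOneSpectrum (𝓞 K3), (ℓ : 𝓞 K3) ∈ v₁.asIdeal ∧ (ℓ : 𝓞 K3) ∈ v₂.asIdeal ∧
      (∀ v : HeightOneSpectrum (𝓞 K3), (ℓ : 𝓞 K3) ∈ v.asIdeal → v = v₁ ∨ v = v₂) ∧ (ℓ % 3 ≠ 1 → v₁ = v₂) := by
  by_cases h1 : ℓ % 3 = 1
  · -- split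
    obtain ⟨a, b, hab, p₁, p₂, -, hprod⟩ := K3.exists_split_of_mod_three_eq_one hℓ h1
    obtain ⟨v₁, hv₁⟩ := exists_asIdeal_eq_span p₁
    obtain ⟨v₂, hv₂⟩ := exists_asIdeal_eq_span p₂
    have hℓmem : ((ℓ : ℤ) : 𝓞 K3) ∈ span {K3.mkInt a b} * span {K3.mkInt (a - b) (-b)} := by
      rw [← hprod]; exact mem_span_singleton_self _
    have hℓ₁ : (ℓ : 𝓞 K3) ∈ v₁.asIdeal := by
      rw [natCast_eq_intCast, hv₁]; exact Ideal.mul_le_right hℓmem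
    have hℓ₂ : (ℓ : 𝓞 K3) ∈ v₂.asIdeal := by
      rw [natCast_eq_intCast, hv₂]; exact Ideal.mul_le_left hℓmem
    refine ⟨v₁, v₂, hℓ₁, hℓ₂, fun v hv ↦ ?_, fun h ↦ absurd h1 h⟩
    rw [natCast_eq_intCast] at hv
    rcases K3.asIdeal_eq_or_of_norm_eq hℓ hab v hv with h | h
    · exact Or.inl (HeightOneSpectrum.ext (by rw [h, hv₁]))
    · exact Or.inr (HeightOneSpectrum.ext (by rw [h, hv₂]))
  · -- `ℓ = 3` or `ℓ ≡ 2 (mod 3)`: a unique place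
    obtain ⟨v, hv⟩ := exists_natCast_mem_asIdeal_three hℓ
    refine ⟨v, v, hv, hv, fun w hw ↦ Or.inl ?_, fun _ ↦ rfl⟩
    have hℓ3 : ℓ = 3 ∨ ℓ % 3 = 2 := by
      by_cases h3 : ℓ = 3
      · exact Or.inl h3
      · right
        have h0 : ℓ % 3 ≠ 0 := fun h0 ↦ h3 ((Nat.prime_dvd_prime_iff_eq Nat.prime_three hℓ).mp
          (Nat.dvd_of_mod_eq_zero h0)).symm
        omega
    rcases hℓ3 with rfl | h2
    · have e3 : ((3 : ℕ) : 𝓞 K3) = 3 := by norm_num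
      rw [e3] at hw hv
      exact HeightOneSpectrum.ext (by rw [K3.asIdeal_eq_of_three_mem w hw, K3.asIdeal_eq_of_three_mem v hv])
    · rw [natCast_eq_intCast] at hw hv
      exact HeightOneSpectrum.ext (by
        rw [K3.asIdeal_eq_of_mod_three_eq_two hℓ h2 w hw, K3.asIdeal_eq_of_mod_three_eq_two hℓ h2 v hv])

omit hEQ in
/-- **A supporting set of places of `ℚ(ζ₃)` with `#S ≤ ω(mn) + ω₂(mn)`**, where `ω₂(mn)` counts the prime factors
`≡ 1 (mod 3)` (split in `ℤ[ζ₃]`): every place containing `m` or `n` lies in `S`. [cite: IrelandRosen1982, Ch. 9 §1 Prop. 9.1.4] -/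
theorem exists_support_split_three (hm : m ≠ 0) (hn : n ≠ 0) :
    ∃ S : Finset (HeightOneSpectrum (𝓞 K3)),
      S.card ≤ (m * n).natAbs.primeFactors.card + ((m * n).natAbs.primeFactors.filter (fun ℓ ↦ ℓ % 3 = 1)).card ∧
      ∀ v : HeightOneSpectrum (𝓞 K3), v ∉ S → ((m : ℤ) : 𝓞 K3) ∉ v.asIdeal ∧ ((n : ℤ) : 𝓞 K3) ∉ v.asIdeal := by
  have hch : ∀ ℓ : (m * n).natAbs.primeFactors, ∃ v₁ v₂ : HeightOneSpectrum (𝓞 K3),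
      ((ℓ : ℕ) : 𝓞 K3) ∈ v₁.asIdeal ∧ ((ℓ : ℕ) : 𝓞 K3) ∈ v₂.asIdeal ∧
      (∀ v : HeightOneSpectrum (𝓞 K3), ((ℓ : ℕ) : 𝓞 K3) ∈ v.asIdeal → v = v₁ ∨ v = v₂) ∧ ((ℓ : ℕ) % 3 ≠ 1 → v₁ = v₂) :=
    fun ℓ ↦ exists_two_places_three (Nat.prime_of_mem_primeFactors ℓ.2)
  choose pl₁ pl₂ hpl₁ hpl₂ hcover hsame using hch
  set F : Finset ↥(m * n).natAbs.primeFactors :=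
    Finset.univ.filter (fun ℓ : ↥(m * n).natAbs.primeFactors ↦ (ℓ : ℕ) % 3 = 1) with hF
  refine ⟨Finset.univ.image pl₁ ∪ F.image pl₂, ?_, fun v hv ↦ ?_⟩
  · have hFcard : F.card ≤ ((m * n).natAbs.primeFactors.filter (fun ℓ ↦ ℓ % 3 = 1)).card := by
      rw [← Finset.card_map (Function.Embedding.subtype (· ∈ (m * n).natAbs.primeFactors))]
      apply Finset.card_le_card
      intro ℓ hℓ
      rw [Finset.mem_map] at hℓ
      obtain ⟨x, hx, rfl⟩ := hℓ
      rw [hF, Finset.mem_filter] at hx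
      exact Finset.mem_filter.mpr ⟨x.2, hx.2⟩
    calc (Finset.univ.image pl₁ ∪ F.image pl₂).card
        ≤ (Finset.univ.image pl₁).card + (F.image pl₂).card := Finset.card_union_le _ _
      _ ≤ (Finset.univ : Finset ↥(m * n).natAbs.primeFactors).card + F.card :=
          Nat.add_le_add Finset.card_image_le Finset.card_image_le
      _ ≤ _ := by rw [Finset.card_univ, Fintype.card_coe]; exact Nat.add_le_add_left hFcard _
  · have hmn0 : (m * n).natAbs ≠ 0 := Int.natAbs_ne_zero.mpr (mul_ne_zero hm hn)
    have key : ∀ z : ℤ, z ∣ m * n → ((z : ℤ) : 𝓞 K3) ∈ v.asIdeal → False := by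
      intro z hz hzv
      obtain ⟨ℓ, hℓ, hℓv⟩ := KubertTateVelu.exists_nat_prime_mem_asIdeal v
      have hℓz : (ℓ : ℤ) ∣ z := natCast_dvd_of_intCast_mem hℓ hℓv hzv
      have hℓmn : ℓ ∈ (m * n).natAbs.primeFactors := by
        rw [Nat.mem_primeFactors]
        exact ⟨hℓ, Int.natCast_dvd.mp (hℓz.trans hz), hmn0⟩
      rcases hcover ⟨ℓ, hℓmn⟩ v hℓv with h | h
      · exact hv (Finset.mem_union_left _ (Finset.mem_image.mpr ⟨⟨ℓ, hℓmn⟩, Finset.mem_univ _, h.symm⟩))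
      · by_cases h1 : ℓ % 3 = 1
        · exact hv (Finset.mem_union_right _ (Finset.mem_image.mpr
            ⟨⟨ℓ, hℓmn⟩, Finset.mem_filter.mpr ⟨Finset.mem_univ _, h1⟩, h.symm⟩))
        · have e := hsame ⟨ℓ, hℓmn⟩ h1
          exact hv (Finset.mem_union_left _ (Finset.mem_image.mpr ⟨⟨ℓ, hℓmn⟩, Finset.mem_univ _, by rw [e, h]⟩))
    exact ⟨fun h ↦ key m (dvd_mul_right m n) h, fun h ↦ key n (dvd_mul_left n m) h⟩

/-! ## §2 The Mordell–Weil rank over `ℚ(ζ₃)` splits along the twist by `-3` -/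

/-- Transport of the Mordell–Weil rank along an equality of curves. [folklore] -/
private theorem mordellWeilRank_congr {F : Type} [Field F] [NumberField F] {V V' : WeierstrassCurve F}
    [V.IsElliptic] [V'.IsElliptic] (e : V = V') : V.mordellWeilRank = V'.mordellWeilRank := by
  subst e; rfl

/-- Transport of `t_p` along an equality of curves. [folklore] -/
private theorem shaCorank_congr {F : Type} [Field F] [NumberField F] {V V' : WeierstrassCurve F}
    [V.IsElliptic] [V'.IsElliptic] (e : V = V') (p : ℕ) [Fact p.Prime] : V.shaCorank p = V'.shaCorank p := by
  subst e; rfl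

/-- **`rank E(ℚ(ζ₃)) = rank E(ℚ) + rank E^{(-3)}(ℚ)`** for `E = E_{m,n}` (tree `mordellWeilRank_baseChange_quadratic_holds` at
`K = K3`, `d_{K3} = -3`, transported to the model `E_{m,n}/K3`). [cite: SilvermanAEC2009, Exercise 10.16] -/
theorem mordellWeilRank_base_eq_add_three [((kubertTateFive (m : ℚ) (n : ℚ)).quadraticTwist (-3)).IsElliptic] :
    haveI := isElliptic_base (K := K3) m n
    (kubertTateFive (m : K3) (n : K3)).mordellWeilRank =
      (kubertTateFive (m : ℚ) (n : ℚ)).mordellWeilRank + ((kubertTateFive (m : ℚ) (n : ℚ)).quadraticTwist (-3)).mordellWeilRank := by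
  haveI := isElliptic_base (K := K3) m n
  haveI : ((kubertTateFive (m : ℚ) (n : ℚ)).baseChange K3).IsElliptic := by
    rw [KubertTateMuDescentNF.baseChange_eq (K := ℚ) m n K3]; infer_instance
  have hd : ((NumberField.discr K3 : ℤ) : ℚ) ≠ 0 := by exact_mod_cast NumberField.discr_ne_zero K3
  haveI : ((kubertTateFive (m : ℚ) (n : ℚ)).quadraticTwist (NumberField.discr K3 : ℚ)).IsElliptic :=
    isElliptic_quadraticTwist _ hd
  have hR := mordellWeilRank_baseChange_quadratic_holds (kubertTateFive (m : ℚ) (n : ℚ)) K3 K3.finrank_eq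
  rw [mordellWeilRank_congr (KubertTateMuDescentNF.baseChange_eq (K := ℚ) m n K3)] at hR
  have h3 : ((NumberField.discr K3 : ℤ) : ℚ) = -3 := by rw [discr_K3]; norm_num
  rw [h3] at hR
  exact hR

/-! ## §3 The rank bounds and the door at `5` on the twist (Eisenstein tame régime) -/

section Main

variable (h5 : ¬ (5 : ℤ) ∣ (kubertTateFive m n).Δ)
  (hbad : ∀ ℓ : ℕ, ℓ.Prime → (ℓ : ℤ) ∣ (kubertTateFive m n).Δ → ℓ % 5 ≠ 1 ∧ (ℓ % 5 = 4 → ℓ % 3 = 1))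
  {x y : ℚ} (hxy : (kubertTateFive (m : ℚ) (n : ℚ)).toAffine.Nonsingular x y) (hx0 : x ≠ 0) (hx : x ≠ m * n)
  (q : ℕ) [Fact q.Prime] (hq5 : q ≠ 5) (hq11 : 2 * q + 1 < 25) (hqΔ : ¬ (q : ℤ) ∣ (kubertTateFive m n).Δ)

include h5 hbad hxy hx0 hx hq5 hq11 hqΔ in
/-- **`rank E_{m,n}(ℚ(ζ₃)) + 1 ≤ ω(mn) + ω₂(mn)` class-wide** in the Eisenstein tame régime (the `μ₅`-box over `ℚ(ζ₃)`,
tree `KubertTateMuDescentNF.mordellWeilRank_succ_le_eisenstein`, at the supporting set of `exists_support_split_three`;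
reference point the rational `(x, y)`, `x ∉ {0, mn}`, good prime `q ≤ 11`). [cite: SilvermanAEC2009, Thm. X.4.2 and Prop. X.4.9]
[cite: Fisher2001FiveSevenDescent, §2] -/
theorem mordellWeilRank_baseChange_succ_le_three :
    haveI := isElliptic_base (K := K3) m n
    (kubertTateFive (m : K3) (n : K3)).mordellWeilRank + 1 ≤
      (m * n).natAbs.primeFactors.card + ((m * n).natAbs.primeFactors.filter (fun ℓ ↦ ℓ % 3 = 1)).card := by
  haveI := isElliptic_base (K := K3) m n
  obtain ⟨hm0, hn0, -⟩ := ne_zero_of_isElliptic (m : ℚ) (n : ℚ)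
  have hm : m ≠ 0 := by exact_mod_cast hm0
  have hn : n ≠ 0 := by exact_mod_cast hn0
  obtain ⟨S, hScard, hS⟩ := exists_support_split_three m n hm hn
  obtain ⟨ψ, hψ⟩ := KubertTateMuDescentNF.exists_dual (K := K3) m n
  have hle := KubertTateMuDescentNF.mordellWeilRank_succ_le_eisenstein m n ψ hψ _ (fun σ ↦ smul_toGeomPoints _ σ _)
    (twentyfive_zsmul_toGeomPoints_cast_ne_zero m n hxy hx0 hx q hq5 hq11 hqΔ) S hS h5 hbad
  exact hle.trans hScard

include h5 hbad hxy hx0 hx hq5 hq11 hqΔ in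
/-- **`rank E_{m,n}^{(-3)}(ℚ) + rank E_{m,n}(ℚ) + 1 ≤ ω(mn) + ω₂(mn)`** (the twist by `d_{ℚ(ζ₃)} = -3`;
`rank E(ℚ(ζ₃)) = rank E(ℚ) + rank E^{(-3)}(ℚ)`). [cite: SilvermanAEC2009, Thm. X.4.2 and Exercise 10.16] -/
theorem mordellWeilRank_twist_le_three [((kubertTateFive (m : ℚ) (n : ℚ)).quadraticTwist (-3)).IsElliptic] :
    ((kubertTateFive (m : ℚ) (n : ℚ)).quadraticTwist (-3)).mordellWeilRank + (kubertTateFive (m : ℚ) (n : ℚ)).mordellWeilRank + 1 ≤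
      (m * n).natAbs.primeFactors.card + ((m * n).natAbs.primeFactors.filter (fun ℓ ↦ ℓ % 3 = 1)).card := by
  have h := mordellWeilRank_baseChange_succ_le_three m n h5 hbad hxy hx0 hx q hq5 hq11 hqΔ
  have hR := mordellWeilRank_base_eq_add_three m n
  omega

include h5 hbad hxy hx0 hx hq5 hq11 hqΔ in
/-- **`rank E_{m,n}^{(-3)}(ℚ) ≤ ω₂(mn)` when the `ℚ`-box is full** (`ω(mn) ≤ rank E_{m,n}(ℚ) + 1`): the rank of the twist by `-3`
of an Eisenstein-tame Kubert–Tate `5`-torsion curve with full `ℚ`-box is at most the number of primes `≡ 1 (mod 3)`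
dividing `mn`. [cite: SilvermanAEC2009, Thm. X.4.2 and Exercise 10.16] [cite: Fisher2001FiveSevenDescent, §2] -/
theorem mordellWeilRank_twist_le_card_split_three [((kubertTateFive (m : ℚ) (n : ℚ)).quadraticTwist (-3)).IsElliptic]
    (hr : (m * n).natAbs.primeFactors.card ≤ (kubertTateFive (m : ℚ) (n : ℚ)).mordellWeilRank + 1) :
    ((kubertTateFive (m : ℚ) (n : ℚ)).quadraticTwist (-3)).mordellWeilRank ≤
      ((m * n).natAbs.primeFactors.filter (fun ℓ ↦ ℓ % 3 = 1)).card := by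
  have h := mordellWeilRank_twist_le_three m n h5 hbad hxy hx0 hx q hq5 hq11 hqΔ
  omega

variable (hr : (m * n).natAbs.primeFactors.card ≤ (kubertTateFive (m : ℚ) (n : ℚ)).mordellWeilRank + 1)
  [htw : ((kubertTateFive (m : ℚ) (n : ℚ)).quadraticTwist (-3)).IsElliptic]
  (hr' : ((m * n).natAbs.primeFactors.filter (fun ℓ ↦ ℓ % 3 = 1)).card ≤
    ((kubertTateFive (m : ℚ) (n : ℚ)).quadraticTwist (-3)).mordellWeilRank)

include h5 hbad hxy hx0 hx hq5 hq11 hqΔ hr hr' in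
/-- **THE DOOR AT `5` ON THE TWIST BY `-3`, DECIDED BY THE RANK (class-wide).** For an Eisenstein-tame `E_{m,n}` with full
`ℚ`-box, if `rank E_{m,n}^{(-3)}(ℚ) ≥ ω₂(mn)` then `t₅(E_{m,n}^{(-3)}/ℚ) = 0`, `t₅(E_{m,n}/ℚ) = 0` and `rank E_{m,n}^{(-3)}(ℚ) = ω₂(mn)` —
`t₅(E_K) = t₅(E) + t₅(E^{(-3)})`, `rank E_K = rank E + rank E^{(-3)}` at `K = ℚ(ζ₃)` (tree `selmerCorank_baseChange_quadratic_holds`,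
`mordellWeilRank_baseChange_quadratic_holds`, Greenberg's `corank Sel = rank + t`), with `t₅(E_K) = 0` (full `K`-box, tree
`KubertTateMuDescentNF.shaCorank_five_eq_zero_of_le_eisenstein`) and `rank E_K + 1 ≤ ω + ω₂`.
[cite: Dokchitser2013ParityNotes, §4] [cite: SilvermanAEC2009, Thm. X.4.2 and Exercise 10.16] -/
theorem twist_door_of_le_rank_three :
    ((kubertTateFive (m : ℚ) (n : ℚ)).quadraticTwist (-3)).shaCorank 5 = 0 ∧
      (kubertTateFive (m : ℚ) (n : ℚ)).shaCorank 5 = 0 ∧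
      ((kubertTateFive (m : ℚ) (n : ℚ)).quadraticTwist (-3)).mordellWeilRank =
        ((m * n).natAbs.primeFactors.filter (fun ℓ ↦ ℓ % 3 = 1)).card := by
  haveI : Fact (Nat.Prime 5) := ⟨Nat.prime_five⟩
  haveI := isElliptic_base (K := K3) m n
  haveI hbc : ((kubertTateFive (m : ℚ) (n : ℚ)).baseChange K3).IsElliptic := by
    rw [KubertTateMuDescentNF.baseChange_eq (K := ℚ) m n K3]; infer_instance
  have hd : ((NumberField.discr K3 : ℤ) : ℚ) ≠ 0 := by exact_mod_cast NumberField.discr_ne_zero K3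
  haveI : ((kubertTateFive (m : ℚ) (n : ℚ)).quadraticTwist (NumberField.discr K3 : ℚ)).IsElliptic :=
    isElliptic_quadraticTwist _ hd
  have hS := selmerCorank_baseChange_quadratic_holds (kubertTateFive (m : ℚ) (n : ℚ)) K3 K3.finrank_eq 5
  have hR := mordellWeilRank_baseChange_quadratic_holds (kubertTateFive (m : ℚ) (n : ℚ)) K3 K3.finrank_eq
  have hK := ((kubertTateFive (m : ℚ) (n : ℚ)).baseChange K3).selmerCorank_eq_mordellWeilRank_add_holds 5
  have hQ := (kubertTateFive (m : ℚ) (n : ℚ)).selmerCorank_eq_mordellWeilRank_add_holds 5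
  have hT := ((kubertTateFive (m : ℚ) (n : ℚ)).quadraticTwist
    (NumberField.discr K3 : ℚ)).selmerCorank_eq_mordellWeilRank_add_holds 5
  -- `t₅(E ⊗ ℚ(ζ₃)) = 0`: the box over `ℚ(ζ₃)` is full since `rank E(ℚ(ζ₃)) + 1 = rank E + rank E^{(-3)} + 1 ≥ ω + ω₂ ≥ #S`
  have h0K : (kubertTateFive (m : K3) (n : K3)).shaCorank 5 = 0 := by
    obtain ⟨hm0, hn0, -⟩ := ne_zero_of_isElliptic (m : ℚ) (n : ℚ)
    have hm : m ≠ 0 := by exact_mod_cast hm0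
    have hn : n ≠ 0 := by exact_mod_cast hn0
    obtain ⟨S, hScard, hS'⟩ := exists_support_split_three m n hm hn
    have hRK := mordellWeilRank_base_eq_add_three m n
    refine KubertTateMuDescentNF.shaCorank_five_eq_zero_of_le_eisenstein m n _ (fun σ ↦ smul_toGeomPoints _ σ _)
      (twentyfive_zsmul_toGeomPoints_cast_ne_zero m n hxy hx0 hx q hq5 hq11 hqΔ) S hS' h5 hbad
      (box_full_of_card_le_rank_succ m n S ?_)
    omega
  have h0 : ((kubertTateFive (m : ℚ) (n : ℚ)).baseChange K3).shaCorank 5 = 0 := by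
    rw [shaCorank_congr (KubertTateMuDescentNF.baseChange_eq (K := ℚ) m n K3) 5]
    exact h0K
  have hbound := mordellWeilRank_twist_le_card_split_three m n h5 hbad hxy hx0 hx q hq5 hq11 hqΔ hr
  have h3 : ((NumberField.discr K3 : ℤ) : ℚ) = -3 := by rw [discr_K3]; norm_num
  rw [h3] at hS hR hT
  omega

omit hr' in
include h5 hbad hxy hx0 hx hq5 hq11 hqΔ hr in
/-- **`ω₂(mn) = 0`: the twist `E_{m,n}^{(-3)}/ℚ` has rank `0` and `t₅ = 0`, unconditionally** (every prime factor of `mn` is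
`3` or `≡ 2 (mod 3)`: ONE place of `ℚ(ζ₃)` above each, so the `K`-box is the `ℚ`-box). [cite: SilvermanAEC2009, Thm. X.4.2 and Exercise 10.16]
[cite: Fisher2001FiveSevenDescent, §2] -/
theorem twist_rank_zero_three (hω : ((m * n).natAbs.primeFactors.filter (fun ℓ ↦ ℓ % 3 = 1)).card = 0) :
    ((kubertTateFive (m : ℚ) (n : ℚ)).quadraticTwist (-3)).mordellWeilRank = 0 ∧
      ((kubertTateFive (m : ℚ) (n : ℚ)).quadraticTwist (-3)).shaCorank 5 = 0 ∧
      (kubertTateFive (m : ℚ) (n : ℚ)).shaCorank 5 = 0 := by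
  have h := twist_door_of_le_rank_three m n h5 hbad hxy hx0 hx q hq5 hq11 hqΔ hr (by rw [hω]; exact Nat.zero_le _)
  rw [hω] at h
  exact ⟨h.2.2, h.1, h.2.1⟩

end Main

end KubertTateEisensteinTwist

end Literature.NumberTheory.EllipticCurves

end
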